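import Mathlib
import Summits.Ventures.PercRepro2.Graph
import Summits.Ventures.PercRepro2.FourFunctions

/-!
# Ahlswede–Daykin inequalities for connection patterns of marked vertices (blind cell PercRepro2, p4)

The four-functions bridge `prob_mul_prob_le_of_sup_inf` (p1, `FourFunctions.lean`) turns every
pair of events `A, B` into the inequality `P(A) P(B) ≤ P(C) P(D)` as soon as joins land in `C`
and meets land in `D`.  For events described by which marked vertices are connected, the join
`ω ⊔ ω'` keeps every connection of either configuration (`conn_mono`) and the meet `ω ⊓ ω'` keeps
every disconnection of either, so "realisability" inequalities between non-monotone pattern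
events follow at once.  Three instances, used by the root-leaf analysis of `S3` (G4-AD):

* `prob_mul_prob_le_three` (three vertices `u v w`): `P(u~v, u~w) · P(u≁v, u≁w, v≁w) ≥ P(u~v, u≁w) · P(u~w, u≁v)`
  — «`u` reaches both roots in the join, nobody reaches anybody in the meet»;
* `prob_mul_prob_le_pair_same` (roots `o, a₂`, marks `a₃, b`):
  `P(o~a₂, a₃~a₂, b~a₂) · P(o≁a₂, a₃≁o, a₃≁a₂, b≁o, b≁a₂) ≥ P(a₃~o, b~o, o≁a₂) · P(a₃~a₂, b~a₂, o≁a₂)`;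
* `prob_mul_prob_le_pair_cross`: the same right-hand side with the cross pair
  `P(a₃~o, b~a₂, o≁a₂) · P(a₃~a₂, b~o, o≁a₂)`.

In the vocabulary of the `(o, a₂)` world (`Q = {o ≁ a₂}`, `L` = with `o`, `H` = with `a₂`, `N` =
neither) these read `P(o,a₃ ∈ C₂)·P(Q, a₃ ∈ N) ≥ P(Q, a₃ ∈ L)·P(Q, a₃ ∈ H)`,
`P(o,a₃,b ∈ C₂)·P(Q,3N,bN) ≥ P(Q,3L,bL)·P(Q,3H,bH)` and `… ≥ P(Q,3L,bH)·P(Q,3H,bL)`.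
-/

namespace Summit.Ventures.PercRepro2

namespace PatternAD

variable {V : Type*} {E : Type*} [Fintype E] [DecidableEq E]
  {R : Type*} [CommRing R] [LinearOrder R] [IsStrictOrderedRing R]

omit [Fintype E] [DecidableEq E] in
/-- A connection of a smaller configuration persists in a larger one (meet form). -/
lemma not_conn_of_le {ends : E → Sym2 V} {ω ω' : Config E} (h : ω ≤ ω') {u v : V}
    (hn : ¬ Conn ends ω' u v) : ¬ Conn ends ω u v :=
  fun hc => hn (conn_mono h hc)

/-- **Three vertices.** If `u` can reach `v` without `w` and can reach `w` without `v`, then with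
at least the product probability it reaches both, times the probability that the three are
pairwise separated. -/
theorem prob_mul_prob_le_three {p : E → R} (hp : IsProbVec p) (ends : E → Sym2 V) (u v w : V) :
    prob p {ω | Conn ends ω u v ∧ ¬ Conn ends ω u w} *
        prob p {ω | Conn ends ω u w ∧ ¬ Conn ends ω u v} ≤
      prob p {ω | Conn ends ω u v ∧ Conn ends ω u w} *
        prob p {ω | ¬ Conn ends ω u v ∧ ¬ Conn ends ω u w ∧ ¬ Conn ends ω v w} := by
  refine prob_mul_prob_le_of_sup_inf hp ?_
  intro ω hω ω' hω'
  obtain ⟨h1, h2⟩ := hω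
  obtain ⟨h3, h4⟩ := hω'
  refine ⟨⟨conn_mono le_sup_left h1, conn_mono le_sup_right h3⟩, ?_, ?_, ?_⟩
  · exact not_conn_of_le inf_le_right h4
  · exact not_conn_of_le inf_le_left h2
  · intro hvw
    exact h2 (conn_trans h1 (conn_mono inf_le_left hvw))

/-- **Two marks, same side.** Roots `o, a₂`, marks `a₃, b`: the configurations where both marks
sit with `o` (and `o ≁ a₂`) times those where both sit with `a₂` are dominated by «everything
joined» times «everything separated». -/
theorem prob_mul_prob_le_pair_same {p : E → R} (hp : IsProbVec p) (ends : E → Sym2 V)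
    (o a₂ a₃ b : V) :
    prob p {ω | Conn ends ω a₃ o ∧ Conn ends ω b o ∧ ¬ Conn ends ω o a₂} *
        prob p {ω | Conn ends ω a₃ a₂ ∧ Conn ends ω b a₂ ∧ ¬ Conn ends ω o a₂} ≤
      prob p {ω | Conn ends ω o a₂ ∧ Conn ends ω a₃ a₂ ∧ Conn ends ω b a₂} *
        prob p {ω | ¬ Conn ends ω o a₂ ∧ ¬ Conn ends ω a₃ o ∧ ¬ Conn ends ω a₃ a₂ ∧
          ¬ Conn ends ω b o ∧ ¬ Conn ends ω b a₂} := by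
  refine prob_mul_prob_le_of_sup_inf hp ?_
  intro ω hω ω' hω'
  obtain ⟨h3o, hbo, hoa⟩ := hω
  obtain ⟨h3a, hba, hoa'⟩ := hω'
  refine ⟨⟨?_, conn_mono le_sup_right h3a, conn_mono le_sup_right hba⟩, ?_, ?_, ?_, ?_, ?_⟩
  · exact conn_trans (conn_symm (conn_mono le_sup_left h3o)) (conn_mono le_sup_right h3a)
  · exact not_conn_of_le inf_le_left hoa
  · -- in `ω'`: `a₃ ~ a₂` and `o ≁ a₂` force `a₃ ≁ o`
    refine not_conn_of_le inf_le_right ?_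
    intro h; exact hoa' (conn_trans (conn_symm h) h3a)
  · refine not_conn_of_le inf_le_left ?_
    intro h; exact hoa (conn_trans (conn_symm h3o) h)
  · refine not_conn_of_le inf_le_right ?_
    intro h; exact hoa' (conn_trans (conn_symm h) hba)
  · refine not_conn_of_le inf_le_left ?_
    intro h; exact hoa (conn_trans (conn_symm hbo) h)

/-- **Two marks, cross sides.** The cross pair `(a₃ with o, b with a₂)` × `(a₃ with a₂, b with o)`
is dominated by the same right-hand side. -/
theorem prob_mul_prob_le_pair_cross {p : E → R} (hp : IsProbVec p) (ends : E → Sym2 V)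
    (o a₂ a₃ b : V) :
    prob p {ω | Conn ends ω a₃ o ∧ Conn ends ω b a₂ ∧ ¬ Conn ends ω o a₂} *
        prob p {ω | Conn ends ω a₃ a₂ ∧ Conn ends ω b o ∧ ¬ Conn ends ω o a₂} ≤
      prob p {ω | Conn ends ω o a₂ ∧ Conn ends ω a₃ a₂ ∧ Conn ends ω b a₂} *
        prob p {ω | ¬ Conn ends ω o a₂ ∧ ¬ Conn ends ω a₃ o ∧ ¬ Conn ends ω a₃ a₂ ∧
          ¬ Conn ends ω b o ∧ ¬ Conn ends ω b a₂} := by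
  refine prob_mul_prob_le_of_sup_inf hp ?_
  intro ω hω ω' hω'
  obtain ⟨h3o, hba, hoa⟩ := hω
  obtain ⟨h3a, hbo, hoa'⟩ := hω'
  refine ⟨⟨?_, conn_mono le_sup_right h3a, conn_mono le_sup_left hba⟩, ?_, ?_, ?_, ?_, ?_⟩
  · exact conn_trans (conn_symm (conn_mono le_sup_left h3o)) (conn_mono le_sup_right h3a)
  · exact not_conn_of_le inf_le_left hoa
  · refine not_conn_of_le inf_le_right ?_
    intro h; exact hoa' (conn_trans (conn_symm h) h3a)
  · refine not_conn_of_le inf_le_left ?_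
    intro h; exact hoa (conn_trans (conn_symm h3o) h)
  · refine not_conn_of_le inf_le_left ?_
    intro h; exact hoa (conn_trans (conn_symm h) hba)
  · refine not_conn_of_le inf_le_right ?_
    intro h; exact hoa' (conn_trans (conn_symm hbo) h)

end PatternAD

end Summit.Ventures.PercRepro2
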